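import Summits.ResolutionOfSingularities.ResolutionOfSingularities.Theorems.FrobeniusLadderFRationalResolutionVertexChartMonoid
import HarnessLib

/-!
# Crux `FrobeniusLadder.FRationalResolution` (stmt-ResolutionOfSingularities-15317), line `redirect`,
# stub `stub_diagonalizableQuotientResolution` — **vertex chart monoids are finitely generated**
# (surface case; discharges the hypothesis `Q.FG` of `…ChartAlgebraFixedPointDim` /
# `…VertexChartRegularity` / `…VertexChartBlowupStep`)

A vertex chart monoid `Q = L + {m v + l x : m ≥ 0, m + c l ≥ 0}` over a finitely generated subgroup
`L ⊆ ℤⁿ` is generated, as a monoid, by `±` a generating set of `L` together with `v`, `x`,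
`y = c v − x` (`fg_of_vertex`). Honest label: bookkeeping toward ONE leaf stub (no stub, crux or summit
closed). No definitions, no named facts, no sorry. [cite: Kato1994, (10.1)]
-/

-- single-problem summit: the doubled namespace component is forced
set_option linter.dupNamespace false

open Summit.ResolutionOfSingularities.ResolutionOfSingularities.Theorems.FRationalResolution.VertexChartMonoid

namespace Summit.ResolutionOfSingularities.ResolutionOfSingularities.Theorems.FRationalResolution.VertexChartFG

variable {n : ℕ} {L : Submodule ℤ (Fin n → ℤ)} {Q : AddSubmonoid (Fin n → ℤ)} {v x : Fin n → ℤ} {c : ℕ}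

/-- An integer multiple of `s` lies in any submonoid containing `s` and `−s`. [folklore] -/
theorem zsmul_mem_of_mem_neg_mem {M : AddSubmonoid (Fin n → ℤ)} {s : Fin n → ℤ} (hs : s ∈ M)
    (hns : -s ∈ M) (k : ℤ) : k • s ∈ M := by
  rcases le_or_gt 0 k with hk | hk
  · lift k to ℕ using hk
    rw [natCast_zsmul]; exact M.nsmul_mem hs _
  · have h1 : k • s = (-k).toNat • (-s) := by
      rw [smul_neg, ← natCast_zsmul, Int.toNat_of_nonneg (by omega), neg_smul, neg_neg]
    rw [h1]; exact M.nsmul_mem hns _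

/-- **Vertex chart monoids are finitely generated** (given a finite generating set of the group `L`):
generators `S ∪ (−S) ∪ {v, x, c v − x}`. [cite: Kato1994, (10.1)] -/
theorem fg_of_vertex (hL : L.FG)
    (hQ : ∀ w, w ∈ Q ↔ ∃ g ∈ L, ∃ m l : ℤ, 0 ≤ m ∧ 0 ≤ m + (c : ℤ) * l ∧ w = g + m • v + l • x)
    (hind : ∀ g ∈ L, ∀ m l : ℤ, g + m • v + l • x = 0 → m = 0 ∧ l = 0) : Q.FG := by
  classical
  obtain ⟨S, hS⟩ := hL
  obtain ⟨⟨hvQ, -⟩, ⟨hxQ, -⟩, ⟨hyQ, -⟩⟩ := vertex_gens_mem hQ hind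
  have hLQ : ∀ g ∈ L, g ∈ Q := fun g hg => (hQ g).2 ⟨g, hg, 0, 0, le_rfl, by simp, by simp⟩
  let T : Finset (Fin n → ℤ) := S ∪ S.image (fun s => -s) ∪ {v, x, (c : ℤ) • v - x}
  have hTmem : ∀ w : Fin n → ℤ, w ∈ (T : Set (Fin n → ℤ)) ↔
      (w ∈ S ∨ ∃ s ∈ S, -s = w) ∨ (w = v ∨ w = x ∨ w = (c : ℤ) • v - x) := by
    intro w
    simp only [T, Finset.coe_union, Finset.coe_image, Finset.coe_insert, Finset.coe_singleton,
      Set.mem_union, Set.mem_image, Finset.mem_coe, Set.mem_insert_iff, Set.mem_singleton_iff]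
  refine ⟨T, le_antisymm ?_ ?_⟩
  · refine AddSubmonoid.closure_le.2 fun w hw => ?_
    rcases (hTmem w).1 hw with (hw | ⟨s, hs, rfl⟩) | rfl | rfl | rfl
    · exact hLQ _ (hS ▸ Submodule.subset_span hw)
    · exact hLQ _ (L.neg_mem (hS ▸ Submodule.subset_span hs))
    · exact hvQ
    · exact hxQ
    · exact hyQ
  · intro w hw
    obtain ⟨g, hg, m, l, hm, hml, rfl⟩ := (hQ w).1 hw
    set M := AddSubmonoid.closure (T : Set (Fin n → ℤ)) with hM
    have hT : ∀ w, ((w ∈ S ∨ ∃ s ∈ S, -s = w) ∨ (w = v ∨ w = x ∨ w = (c : ℤ) • v - x)) → w ∈ M :=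
      fun w hw => AddSubmonoid.subset_closure ((hTmem w).2 hw)
    have hvM : v ∈ M := hT v (Or.inr (Or.inl rfl))
    have hxM : x ∈ M := hT x (Or.inr (Or.inr (Or.inl rfl)))
    have hyM : (c : ℤ) • v - x ∈ M := hT _ (Or.inr (Or.inr (Or.inr rfl)))
    -- `L ≤ M`
    have hgM : g ∈ M := by
      rw [← hS] at hg
      obtain ⟨f, -, hf⟩ := Submodule.mem_span_finset.1 hg
      rw [← hf]
      refine AddSubmonoid.sum_mem _ fun s hs => ?_
      exact zsmul_mem_of_mem_neg_mem (hT s (Or.inl (Or.inl hs))) (hT (-s) (Or.inl (Or.inr ⟨s, hs, rfl⟩))) _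
    -- the cone part
    rcases le_or_gt 0 l with hl | hl
    · have e : g + m • v + l • x = g + m.toNat • v + l.toNat • x := by
        rw [← natCast_zsmul v, ← natCast_zsmul x, Int.toNat_of_nonneg hm, Int.toNat_of_nonneg hl]
      rw [e]
      exact M.add_mem (M.add_mem hgM (M.nsmul_mem hvM _)) (M.nsmul_mem hxM _)
    · -- `m v + l x = (m + c l) v + |l| y`
      have e : g + m • v + l • x =
          g + (m + (c : ℤ) * l).toNat • v + (-l).toNat • ((c : ℤ) • v - x) := by
        rw [← natCast_zsmul v, ← natCast_zsmul ((c : ℤ) • v - x), Int.toNat_of_nonneg hml,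
          Int.toNat_of_nonneg (by omega : 0 ≤ -l)]
        module
      rw [e]
      exact M.add_mem (M.add_mem hgM (M.nsmul_mem hvM _)) (M.nsmul_mem hyM _)

end Summit.ResolutionOfSingularities.ResolutionOfSingularities.Theorems.FRationalResolution.VertexChartFG
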